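import Summits.CriticalPhenomena.Ising3DConformalLimit.Theses.ArmHyperscaling
import Summits.CriticalPhenomena.Ising3DConformalLimit.Theorems.HyperoctahedralRPHRP2Rigidity
import Summits.CriticalPhenomena.Ising3DConformalLimit.Theorems.HyperoctahedralRPLimitRotationInvariant
import HarnessLib

/-!
# Crux `ArmHyperscaling.IsotropyFromOneArm` (stmt-CriticalPhenomena-15593) — PROVED
# (line `landed-composition`, lead prover `prover-line-stmt-CriticalPhenomena-15593-0`, 2026-08-17)

**Isotropy from one-arm hyperscaling.**  Route `ArmHyperscaling` of `Ising3DConformalLimit` posits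
`IsotropyFromOneArm`: assuming the one-arm hyperscaling bound for the critical `ℤ³` Ising model, every normalised,
non-degenerate, translation-invariant, scale-covariant pointwise scaling limit of the critical correlators
`criticalCorr 3` is `O(3)`-invariant at all orders.  This file closes the item: the composition below is the complete,
sorry-free proof (ZERO stubs; the registered skeleton `Cruxes/IsotropyFromOneArm/Lines/landed_composition.lean` of the
crux-plan seat, landed verbatim — merge-twin of `Lines/landed_isotropy.lean`, same proof term).

The crux reads `OneArmHyperscaling → C` with
`C := ∀ ρ Δ S, (ρ > 0 on (0,1]) → HasPointwiseScalingLimit (criticalCorr 3) ρ S → (S = 0 off NonCoincident) →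
IsNondegenerateTwoPoint S → IsTranslationInvariant S → IsScaleCovariant Δ S → IsRotationInvariant S`.
`C` is, token for token, the consequent of the route decl `HyperoctahedralRP.LimitRotationInvariant := HRP2Rigidity → C`
(crux stmt-CriticalPhenomena-1980), and both PIECES are landed theorems of the tree:

* piece 1 — `HyperoctahedralRP.HRP2Rigidity` (stmt-CriticalPhenomena-1979, closed `proved`):
  `Cruxes.HRP2Rigidity.XRayMellin.HRP2Rigidity_of` (`Theorems/HyperoctahedralRPHRP2Rigidity.lean`);
* piece 2 — `HyperoctahedralRP.LimitRotationInvariant` (stmt-CriticalPhenomena-1980, closed `proved`):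
  `Cruxes.LimitRotationInvariant.QuarterTurnLiouville.limitRotationInvariant_proof`
  (`Theorems/HyperoctahedralRPLimitRotationInvariant.lean`, through crux stmt-8367 `rotationUpgradeFromTwoPoint_proof`).

Composition: `IsotropyFromOneArm_of : IsotropyFromOneArm := fun _ => limitRotationInvariant_proof HRP2Rigidity_of` (closed, by name;
the one-arm antecedent is NOT consumed); the skeleton shape over the pieces is recorded as
`IsotropyFromOneArm_of_pieces : HRP2Rigidity → LimitRotationInvariant → IsotropyFromOneArm := fun h₁ h₂ _ => h₂ h₁`.
No `stub_*`: nothing is left to prove.  The standing disproof work file `Cruxes/IsotropyFromOneArm/Disproof.lean` §0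
(`crux_proved`, `consequent_holds`) records the same term and that no `_false_without_<H>` can hold — the proof consumes
no hypothesis `H` of the crux; its §A/§B witnesses (`Theorems/IsotropyFromOneArm/Negative/LoadBearing.lean`) show that in
the CONSEQUENT the lattice-limit hypothesis (H2) and the normalisation (H3) are load-bearing, which this proof respects
(both are used inside `limitRotationInvariant_proof`).

Route-level remark (the planner's business, recorded by the rattack / cstrat / triage seats): `ArmHyperscaling.closes`
consumes `hOA : OneArmHyperscaling` (stmt-CriticalPhenomena-15591) only through `hRot : IsotropyFromOneArm`, which ignores
it, so after this file the one-arm bound is no longer load-bearing for isotropy on this route.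
-/

noncomputable section

namespace Summit.CriticalPhenomena.Ising3DConformalLimit.Cruxes.IsotropyFromOneArm.LandedComposition

/-- **`IsotropyFromOneArm_of`** — crux `ArmHyperscaling.IsotropyFromOneArm` (item stmt-CriticalPhenomena-15593) BY NAME,
sorry-free, ZERO stubs: the landed theorem `limitRotationInvariant_proof` (crux stmt-1980) applied to the landed theorem
`HRP2Rigidity_of` (crux stmt-1979); the one-arm hypothesis `_hOA` is discarded. -/
theorem IsotropyFromOneArm_of :
    _root_.Summit.CriticalPhenomena.Ising3DConformalLimit.Theses.ArmHyperscaling.IsotropyFromOneArm :=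
  fun _hOA =>
    _root_.Summit.CriticalPhenomena.Ising3DConformalLimit.Cruxes.LimitRotationInvariant.QuarterTurnLiouville.limitRotationInvariant_proof
      _root_.Summit.CriticalPhenomena.Ising3DConformalLimit.Cruxes.HRP2Rigidity.XRayMellin.HRP2Rigidity_of

/-- Same theorem under the `<decl>_proof` naming used by the closing files of cruxes 1979 / 1980 / 8367 (the name a lead
prover lands in `Theorems/ArmHyperscalingIsotropyFromOneArm.lean`). -/
theorem isotropyFromOneArm_proof :
    _root_.Summit.CriticalPhenomena.Ising3DConformalLimit.Theses.ArmHyperscaling.IsotropyFromOneArm :=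
  IsotropyFromOneArm_of

/-- **The composition over the two pieces** (the skeleton shape `piece₁ → piece₂ → crux`, both pieces LANDED route decls of
`HyperoctahedralRP`): `HRP2Rigidity → LimitRotationInvariant → IsotropyFromOneArm` is modus ponens
(`LimitRotationInvariant` unfolds to `HRP2Rigidity → C`, `IsotropyFromOneArm` to `OneArmHyperscaling → C`). -/
theorem IsotropyFromOneArm_of_pieces :
    _root_.Summit.CriticalPhenomena.Ising3DConformalLimit.Theses.HyperoctahedralRP.HRP2Rigidity →
    _root_.Summit.CriticalPhenomena.Ising3DConformalLimit.Theses.HyperoctahedralRP.LimitRotationInvariant →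
    _root_.Summit.CriticalPhenomena.Ising3DConformalLimit.Theses.ArmHyperscaling.IsotropyFromOneArm :=
  fun h1979 h1980 _hOA => h1980 h1979

/-- The pieces-composition fed with the two landed theorems is (definitionally) the proof above. -/
example : _root_.Summit.CriticalPhenomena.Ising3DConformalLimit.Theses.ArmHyperscaling.IsotropyFromOneArm :=
  IsotropyFromOneArm_of_pieces
    _root_.Summit.CriticalPhenomena.Ising3DConformalLimit.Cruxes.HRP2Rigidity.XRayMellin.HRP2Rigidity_of
    _root_.Summit.CriticalPhenomena.Ising3DConformalLimit.Cruxes.LimitRotationInvariant.QuarterTurnLiouville.limitRotationInvariant_proof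

/-- Mechanical cross-check of the "token for token" claim (the Transfer C⁺ → crux): the crux is definitionally the
weakening of `HyperoctahedralRP.LimitRotationInvariant`'s consequent by the one-arm antecedent. -/
example :
    _root_.Summit.CriticalPhenomena.Ising3DConformalLimit.Theses.HyperoctahedralRP.LimitRotationInvariant →
    _root_.Summit.CriticalPhenomena.Ising3DConformalLimit.Theses.ArmHyperscaling.IsotropyFromOneArm :=
  fun h _ => h _root_.Summit.CriticalPhenomena.Ising3DConformalLimit.Cruxes.HRP2Rigidity.XRayMellin.HRP2Rigidity_of

end Summit.CriticalPhenomena.Ising3DConformalLimit.Cruxes.IsotropyFromOneArm.LandedComposition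

end
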